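import Summits.BirchSwinnertonDyer.BirchSwinnertonDyer.Theorems.BiquadraticEisensteinDescentManinDatumSupercuspidalCMInertSevenDivisionTameCharacter
import Summits.BirchSwinnertonDyer.BirchSwinnertonDyer.Theorems.InertBadSignedBranchesInertBadAtThreeQuarticTorsionCoordinates
import Literature.NumberTheory.QuadraticFields.GaussianQuarticCharMod
import Mathlib.FieldTheory.IntermediateField.Adjoin.Basic
import Mathlib.RingTheory.UniqueFactorizationDomain.Basic
import HarnessLib

set_option linter.dupNamespace false -- `Summit.BirchSwinnertonDyer.BirchSwinnertonDyer.Theorems.…` (summit = sub, D-0017)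
set_option autoImplicit false

/-!
# Crux `ManinDatumSupercuspidalCMInert` (stmt-BirchSwinnertonDyer-20111, BED r605), CM side of H₇ — step (d) of memo PLAIN-ODD-57,
# fourth brick (a): the base field `ℚ(i) ⊂ ℂ`, its `7`-adic values, and the `7`-division points of `y² = x³ − x` as the common roots of
# `ψ₇(x) = 0`, `y² = x³ − x`

Route `BiquadraticEisensteinDescent` (cell `pub/bsd-wall`, width seat `bsd-wall-cm-bed-w4` g11, RESOLVENT/GALOIS LANE; `--supports`
stmt-BirchSwinnertonDyer-20111, helper). THEOREMS ONLY (no definition, no named fact, no `sorry`); nothing is closed by this file and BSD is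
not proved by any of it.

* §1 `ℚ⟮i⟯ ⊂ ℂ` (Mathlib `IntermediateField.adjoin ℚ {I}`): `isIntegral_I`, `exists_rat_of_mem_adjoin_I` (`x ∈ ℚ(i) ⇒ x = a + bi`),
  `toComplex_mem_adjoin_I` (`ℤ[i] ⊂ ℚ(i)`);
* §2 for every valuation `v` of `ℂ` with `v 7 < 1`: `val_toComplex_eq_one` (`7 ∤ z ⇒ v z = 1`, via `z z̄ = N(z)`, `7 ∤ N(z)` as `7 ≡ 3 (4)`),
  `exists_val_toComplex_eq_pow` (`v z ∈ v(7)^ℕ` for `z ≠ 0`), ★ `exists_val_eq_zpow_of_mem_adjoin_I` (`v x ∈ v(7)^ℤ` for `x ∈ ℚ(i)ˣ`: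
  `ℚ(i)` is UNRAMIFIED at the inert prime `7`);
* §3 ★ `exists_eq_division_point` — if `ψ₇(x) = 0` (bed-w4 g10's explicit `preΨ'_seven_lemniscate`) and `y² = x³ − x` then
  `(x, y) = (X_d, Y_d) = (℘(d/7)/ϖ₀², ℘′(d/7)/(2ϖ₀³))` for some `d ∈ ℤ[i] ∖ 7ℤ[i]` (`℘` onto, tree `eval_ΨSq_weierstrassP_eq_zero_iff`,
  `Y_{−d} = −Y_d`): the `48` points `P_d` are ALL the `7`-division points;
* §4 `isIntegral_X`, `isIntegral_Y` — `X_c`, `Y_c` are algebraic over `ℚ` (tree `torsion_coord_isIntegral`: `49X_c, 343Y_c ∈ ℤ̄`).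

The sequel (`…SevenDivisionGalois`) uses §3–§4 to show that every `ℚ(i)`-embedding of `K = ℚ(i)(X_c, Y_c : c)` into `ℂ` permutes the
`P_c` `ℤ[i]`-linearly and that `K/ℚ(i)` is Galois of degree `48` with group `(ℤ[i]/7)ˣ`.
References: [SilvermanAEC2009] III.1, VI.3.6, Ex. 3.7; [SilvermanATAEC1994] II.1–II.2, II.5; [Serre1979] Ch. I §6.
-/

noncomputable section

open Complex PeriodPair Polynomial
open scoped PeriodPair IntermediateField
open Literature.NumberTheory.EllipticCurves Literature.NumberTheory.EllipticCurves.GaussianLattice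

namespace Summit.BirchSwinnertonDyer.BirchSwinnertonDyer.Theorems.BiquadraticEisensteinDescentManinDatumSupercuspidalCMInertSevenDivisionField

open Summit.BirchSwinnertonDyer.BirchSwinnertonDyer.Theorems.BiquadraticEisensteinDescentManinDatumSupercuspidalCMInertSevenDivisionEisenstein
  (val_intCast_le_one preΨ'_seven_lemniscate ΨSq_seven_lemniscate psi_seven_weierstrassP_div)
open Summit.BirchSwinnertonDyer.BirchSwinnertonDyer.Theorems.BiquadraticEisensteinDescentManinDatumSupercuspidalCMInertFormalChord
  (val_natCast_eq_one_of_coprime_seven val_natCast_le_one)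
open Summit.BirchSwinnertonDyer.BirchSwinnertonDyer.Theorems.BiquadraticEisensteinDescentManinDatumSupercuspidalCMInertSevenDivisionPoints
open Summit.BirchSwinnertonDyer.BirchSwinnertonDyer.Theorems.InertBadSignedBranchesInertBadAtThreeQuarticCleanAssembly (toComplex_mem_lattice)
open Summit.BirchSwinnertonDyer.BirchSwinnertonDyer.Theorems.InertBadSignedBranchesInertBadAtThreeQuarticTorsionCoordinates
  (torsion_coord_isIntegral)

/-! ## §1 The field `ℚ(i) ⊂ ℂ` -/

section GaussField

/-- `i` is integral over `ℚ` (`i² + 1 = 0`). [folklore] -/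
theorem isIntegral_I : IsIntegral ℚ I :=
  ⟨X ^ 2 + C 1, monic_X_pow_add_C 1 two_ne_zero, by simp⟩

/-- `i ∈ ℚ⟮i⟯`. [folklore] -/
theorem I_mem_adjoin_I : I ∈ ℚ⟮I⟯ := IntermediateField.mem_adjoin_simple_self ℚ I

/-- **Every element of `ℚ⟮i⟯ ⊂ ℂ` is `a + bi` with `a, b ∈ ℚ`** (`ℚ⟮i⟯ = ℚ[i]` since `i` is algebraic; reduce modulo `X² + 1`). [folklore] -/
theorem exists_rat_of_mem_adjoin_I {x : ℂ} (hx : x ∈ ℚ⟮I⟯) : ∃ a b : ℚ, x = a + b * I := by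
  rw [← IntermediateField.mem_toSubalgebra, IntermediateField.adjoin_simple_toSubalgebra_of_isAlgebraic isIntegral_I.isAlgebraic,
    Algebra.adjoin_singleton_eq_range_aeval] at hx
  obtain ⟨p, rfl⟩ := hx
  -- reduce `p` modulo the monic `X² + 1`
  set q : ℚ[X] := X ^ 2 + C 1 with hq
  have hroot : aeval I q = 0 := by simp [hq]
  have hmod : aeval I (p %ₘ q) = aeval I p := by
    conv_rhs => rw [← Polynomial.modByMonic_add_div p q]
    rw [map_add, map_mul, hroot, zero_mul, add_zero]
  have hdeg : (p %ₘ q).degree ≤ 1 := by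
    have hqm : q.Monic := monic_X_pow_add_C 1 two_ne_zero
    have h := Polynomial.degree_modByMonic_lt p hqm
    have hq2 : q.degree = 2 := by
      rw [hq]; compute_degree!
    rw [hq2] at h
    exact Order.le_of_lt_succ (by exact_mod_cast h)
  set r : ℚ[X] := p %ₘ q with hr
  have hrX : r = C (r.coeff 1) * X + C (r.coeff 0) := Polynomial.eq_X_add_C_of_degree_le_one hdeg
  have key : aeval I r = ((r.coeff 0 : ℚ) : ℂ) + ((r.coeff 1 : ℚ) : ℂ) * I := by
    conv_lhs => rw [hrX]
    simp only [map_add, map_mul, aeval_C, aeval_X, eq_ratCast]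
    ring
  refine ⟨r.coeff 0, r.coeff 1, ?_⟩
  change (aeval I) p = _
  rw [← hmod]
  exact key

/-- `a + bi ∈ ℚ⟮i⟯` for `a, b ∈ ℚ`. [folklore] -/
theorem rat_add_rat_mul_I_mem (a b : ℚ) : (a : ℂ) + b * I ∈ ℚ⟮I⟯ := by
  refine add_mem ?_ (mul_mem ?_ I_mem_adjoin_I)
  · exact_mod_cast (ℚ⟮I⟯).algebraMap_mem a
  · exact_mod_cast (ℚ⟮I⟯).algebraMap_mem b

/-- **`ℤ[i] ⊂ ℚ⟮i⟯`**: every Gaussian integer lies in `ℚ⟮i⟯`. [folklore] -/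
theorem toComplex_mem_adjoin_I (z : GaussianInt) : ((z : GaussianInt) : ℂ) ∈ ℚ⟮I⟯ := by
  rw [GaussianInt.toComplex_def]
  have := rat_add_rat_mul_I_mem (z.re : ℚ) (z.im : ℚ)
  push_cast at this
  exact this

end GaussField

/-! ## §2 `7`-adic values on `ℚ(i)`: unramified at the inert prime `7` -/

section Values

variable {Γ₀ : Type*} [LinearOrderedCommGroupWithZero Γ₀] (v : Valuation ℂ Γ₀)

/-- Gaussian integers are `v`-integral. [folklore] -/
theorem val_toComplex_le_one (z : GaussianInt) : v ((z : GaussianInt) : ℂ) ≤ 1 := by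
  have hvI : v I = 1 := by
    apply pow_left_injective (by norm_num : (4 : ℕ) ≠ 0)
    dsimp only
    rw [← Valuation.map_pow, Complex.I_pow_four, Valuation.map_one, one_pow]
  rw [GaussianInt.toComplex_def]
  refine Valuation.map_add_le v (val_intCast_le_one v z.re) ?_
  rw [Valuation.map_mul, hvI, mul_one]
  exact val_intCast_le_one v z.im

/-- **`v z = 1` for `z ∈ ℤ[i]` with `7 ∤ z`** (`v 7 < 1`): `z z̄ = N(z) ∈ ℤ` is prime to `7` because `7 ≡ 3 (mod 4)` is inert, so
`v(z) v(z̄) = 1` with both factors `≤ 1`. [cite: IrelandRosen1982, Ch. 9 §7 Lemma 4] -/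
theorem val_toComplex_eq_one (h7 : v 7 < 1) {z : GaussianInt} (hz : ¬ (7 : GaussianInt) ∣ z) :
    v ((z : GaussianInt) : ℂ) = 1 := by
  -- `7 ∤ N(z)`
  have hN : ¬ ((7 : ℕ) : ℤ) ∣ z.norm := fun h ↦
    hz ((Literature.NumberTheory.QuadraticFields.GaussianQuarticSymbol.natCast_dvd_norm_iff (q := 7) (by norm_num) (by norm_num) z).mp h)
  have hN' : ¬ 7 ∣ z.norm.natAbs := fun h ↦ hN (Int.natCast_dvd.mpr h)
  have hNnat : Nat.Coprime z.norm.natAbs 7 := ((Nat.Prime.coprime_iff_not_dvd (by norm_num)).mpr hN').symm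
  have hvN : v ((z.norm.natAbs : ℕ) : ℂ) = 1 := val_natCast_eq_one_of_coprime_seven v h7 hNnat
  have hnorm : ((z : GaussianInt) : ℂ) * ((star z : GaussianInt) : ℂ) = ((z.norm.natAbs : ℕ) : ℂ) := by
    have h0 : (0 : ℤ) ≤ z.norm := GaussianInt.norm_nonneg z
    have hcast : ((z.norm.natAbs : ℕ) : ℂ) = ((z.norm : ℤ) : ℂ) := by
      rw [← Int.cast_natCast, Int.natAbs_of_nonneg h0]
    rw [hcast, ← map_intCast GaussianInt.toComplex z.norm, Zsqrtd.norm_eq_mul_conj, map_mul]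
  have hle1 := val_toComplex_le_one v z
  have hle2 := val_toComplex_le_one v (star z)
  have hprod : v ((z : GaussianInt) : ℂ) * v ((star z : GaussianInt) : ℂ) = 1 := by
    rw [← Valuation.map_mul, hnorm, hvN]
  by_contra hne
  have hlt : v ((z : GaussianInt) : ℂ) < 1 := lt_of_le_of_ne hle1 hne
  have : v ((z : GaussianInt) : ℂ) * v ((star z : GaussianInt) : ℂ) < 1 := mul_lt_one_of_lt_of_le hlt hle2
  rw [hprod] at this
  exact lt_irrefl _ this

/-- `v z ∈ v(7)^ℕ` for every non-zero Gaussian integer (`z = 7ᵐ z′`, `7 ∤ z′`). [folklore] -/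
theorem exists_val_toComplex_eq_pow (h7 : v 7 < 1) {z : GaussianInt} (hz : z ≠ 0) :
    ∃ m : ℕ, v ((z : GaussianInt) : ℂ) = v 7 ^ m := by
  have hirr : Irreducible (7 : GaussianInt) := by
    have := Literature.NumberTheory.QuadraticFields.GaussianQuarticSymbol.prime_natCast_of_mod_four_eq_three' (q := 7)
      (by norm_num) (by norm_num)
    exact_mod_cast this.irreducible
  obtain ⟨m, z', hz', rfl⟩ := WfDvdMonoid.max_power_factor hz hirr
  refine ⟨m, ?_⟩
  rw [map_mul, map_pow, map_ofNat, Valuation.map_mul, Valuation.map_pow, val_toComplex_eq_one v h7 hz', mul_one]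

/-- `v n = v(7)^e` for a natural number `n = 7ᵉ n′ ≠ 0`, `7 ∤ n′`. [folklore] -/
theorem exists_val_natCast_eq_pow (h7 : v 7 < 1) {n : ℕ} (hn : n ≠ 0) : ∃ e : ℕ, v (n : ℂ) = v 7 ^ e := by
  obtain ⟨e, n', hn', hn⟩ := Nat.exists_eq_pow_mul_and_not_dvd hn 7 (by norm_num)
  refine ⟨e, ?_⟩
  rw [hn]
  push_cast
  rw [Valuation.map_mul, Valuation.map_pow,
    val_natCast_eq_one_of_coprime_seven v h7 ((Nat.Prime.coprime_iff_not_dvd (by norm_num)).mpr hn').symm, mul_one]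

/-- ★ **`ℚ(i)` is unramified at `7`**: every non-zero `x ∈ ℚ⟮i⟯` has `v x = v(7)^m` for some `m ∈ ℤ`. [cite: IrelandRosen1982, Ch. 9 §7 Lemma 4] -/
theorem exists_val_eq_zpow_of_mem_adjoin_I (h7 : v 7 < 1) {x : ℂ} (hx : x ∈ ℚ⟮I⟯) (hx0 : x ≠ 0) :
    ∃ m : ℤ, v x = v 7 ^ m := by
  obtain ⟨a, b, rfl⟩ := exists_rat_of_mem_adjoin_I hx
  -- clear denominators: `N x = z` with `N = a.den * b.den`, `z ∈ ℤ[i]`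
  set N : ℕ := a.den * b.den with hN
  have hN0 : N ≠ 0 := mul_ne_zero a.den_nz b.den_nz
  set z : GaussianInt := ⟨a.num * b.den, b.num * a.den⟩ with hzdef
  have hxz : (N : ℂ) * ((a : ℂ) + b * I) = ((z : GaussianInt) : ℂ) := by
    rw [hzdef, GaussianInt.toComplex_def', hN]
    have ha : (a : ℂ) = (a.num : ℂ) / (a.den : ℂ) := by exact_mod_cast (Rat.num_div_den a).symm
    have hb : (b : ℂ) = (b.num : ℂ) / (b.den : ℂ) := by exact_mod_cast (Rat.num_div_den b).symm
    rw [ha, hb]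
    have had : (a.den : ℂ) ≠ 0 := by exact_mod_cast a.den_nz
    have hbd : (b.den : ℂ) ≠ 0 := by exact_mod_cast b.den_nz
    push_cast
    field_simp
  have hz0 : z ≠ 0 := by
    intro h
    rw [h, map_zero, mul_eq_zero] at hxz
    rcases hxz with h' | h'
    · exact hN0 (by exact_mod_cast h')
    · exact hx0 h'
  obtain ⟨e, he⟩ := exists_val_natCast_eq_pow v h7 hN0
  obtain ⟨m, hm⟩ := exists_val_toComplex_eq_pow v h7 hz0
  refine ⟨(m : ℤ) - e, ?_⟩
  have h70 : v 7 ≠ 0 := (Valuation.ne_zero_iff v).mpr (by norm_num)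
  have hvN : v (N : ℂ) ≠ 0 := by rw [he]; exact pow_ne_zero _ h70
  have := congrArg v hxz
  rw [Valuation.map_mul, he, hm] at this
  rw [zpow_sub₀ h70, zpow_natCast, zpow_natCast, eq_div_iff (pow_ne_zero _ h70), mul_comm]
  exact this

end Values

/-! ## §3 The `7`-division points are exactly the `P_d`, `d ∈ ℤ[i] ∖ 7ℤ[i]` -/

section DivisionPoints

/-- ★ **Common roots of `ψ₇(x) = 0`, `y² = x³ − x` are division values.** If `x, y ∈ ℂ` satisfy the explicit `7`-division equation
`7x²⁴ − 308x²² − ⋯ − 196x² − 1 = 0` and `y² = x³ − x`, then `x = ℘(d/7)/ϖ₀²` and `y = ℘′(d/7)/(2ϖ₀³)` for some `d ∈ ℤ[i]` with `7 ∤ d`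
(`℘` is onto `ℂ`; `ΨSq₇(℘(z)) = 0 ↔ 7z ∈ Λ`; the sign of `y` is absorbed by `d ↦ −d`). [cite: SilvermanAEC2009, Prop. VI.3.6 (b), Ex. 3.7 (d),(f)] -/
theorem exists_eq_division_point {x y : ℂ}
    (hx : 7 * x ^ 24 - 308 * x ^ 22 - 2954 * x ^ 20 + 19852 * x ^ 18 - 35231 * x ^ 16 + 82264 * x ^ 14
      - 111916 * x ^ 12 + 42168 * x ^ 10 + 15673 * x ^ 8 - 14756 * x ^ 6 + 1302 * x ^ 4 - 196 * x ^ 2 - 1 = 0)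
    (hy : y ^ 2 = x ^ 3 - x) :
    ∃ d : GaussianInt, ¬ (7 : GaussianInt) ∣ d ∧
      x = ℘[ofUpperHalfPlane UpperHalfPlane.I] (((d : GaussianInt) : ℂ) / 7) / ((Real.Gamma (1 / 4) ^ 2 / (2 * Real.sqrt (2 * Real.pi)) : ℝ) : ℂ) ^ 2 ∧
      y = ℘'[ofUpperHalfPlane UpperHalfPlane.I] (((d : GaussianInt) : ℂ) / 7) / (2 * ((Real.Gamma (1 / 4) ^ 2 / (2 * Real.sqrt (2 * Real.pi)) : ℝ) : ℂ) ^ 3) := by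
  set ϖ : ℂ := ((Real.Gamma (1 / 4) ^ 2 / (2 * Real.sqrt (2 * Real.pi)) : ℝ) : ℂ) with hϖ
  have hϖ0 : ϖ ≠ 0 := Complex.ofReal_ne_zero.mpr varpi_pos.ne'
  set L' : PeriodPair := (ofUpperHalfPlane UpperHalfPlane.I).mulLeft ϖ hϖ0 with hL'
  have hg2 : L'.g₂ = 4 := by
    rw [hL', PeriodPair.g₂_mulLeft, g₂_eq_varpi', ← hϖ]
    field_simp
  have hg3 : L'.g₃ = 0 := by
    rw [hL', PeriodPair.g₃_mulLeft, g₃_ofUpperHalfPlane_I, mul_zero]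
  have hW : (⟨0, 0, 0, -1, 0⟩ : WeierstrassCurve ℤ).map (algebraMap ℤ ℂ) = L'.curve :=
    PeriodPair.map_eq_curve (by rw [hg2]; norm_num) (by rw [hg3]; norm_num)
  -- `x = ℘[L'] z'` for some `z' ∉ L'`
  obtain ⟨z', hz', hxz'⟩ := PeriodPair.exists_weierstrassP_eq (L := L') x
  -- `7 z' ∈ L'.lattice` from `ΨSq₇(x) = 0`
  have hΨ : (L'.curve.ΨSq ((7 : ℕ) : ℤ)).eval (℘[L'] z') = 0 := by
    rw [← hW, WeierstrassCurve.map_ΨSq, Polynomial.eval_map, ← Polynomial.aeval_def, ΨSq_seven_lemniscate, map_pow,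
      preΨ'_seven_lemniscate, hxz']
    simp only [map_sub, map_add, map_mul, map_pow, aeval_X, map_one, map_ofNat]
    rw [hx, zero_pow two_ne_zero]
  have h7z' : (((7 : ℕ) : ℤ) : ℂ) * z' ∈ L'.lattice := (PeriodPair.eval_ΨSq_weierstrassP_eq_zero_iff L' hz' _).mp hΨ
  -- back to `Λ = ℤi + ℤ`: `z' = ϖ z`, `7z ∈ Λ`, `z ∉ Λ`
  set z : ℂ := ϖ⁻¹ * z' with hzdef
  have hz'eq : z' = ϖ * z := by rw [hzdef, ← mul_assoc, mul_inv_cancel₀ hϖ0, one_mul]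
  have hz : z ∉ (ofUpperHalfPlane UpperHalfPlane.I).lattice := by
    intro h; apply hz'
    rw [hz'eq, hL', PeriodPair.mul_mem_mulLeft_lattice]; exact h
  have h7z : (7 : ℂ) * z ∈ (ofUpperHalfPlane UpperHalfPlane.I).lattice := by
    have : (((7 : ℕ) : ℤ) : ℂ) * z' = ϖ * ((7 : ℂ) * z) := by rw [hz'eq]; push_cast; ring
    rw [this, hL', PeriodPair.mul_mem_mulLeft_lattice] at h7z'
    exact h7z'
  obtain ⟨m, n, hmn⟩ := mem_lattice_iff.mp h7z
  -- `z = d/7` with `d = n + m i`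
  set d : GaussianInt := ⟨n, m⟩ with hd
  have hzd : z = ((d : GaussianInt) : ℂ) / 7 := by
    rw [hd, GaussianInt.toComplex_def']
    linear_combination (-(1 : ℂ) / 7) * hmn
  have hd7 : ¬ (7 : GaussianInt) ∣ d := fun h ↦ hz (hzd ▸ (div_seven_mem_lattice_iff d).mpr h)
  -- `x = X_d`
  have hxd : x = ℘[ofUpperHalfPlane UpperHalfPlane.I] (((d : GaussianInt) : ℂ) / 7) / ϖ ^ 2 := by
    rw [← hxz', hz'eq, hL', PeriodPair.weierstrassP_mulLeft, hzd]
    ring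
  -- `y = ± Y_d`
  have hcur := curve_X_Y hd7
  have hy2 : y ^ 2 = (℘'[ofUpperHalfPlane UpperHalfPlane.I] (((d : GaussianInt) : ℂ) / 7) / (2 * ϖ ^ 3)) ^ 2 := by
    rw [hy, hcur, hxd]
  rcases sq_eq_sq_iff_eq_or_eq_neg.mp hy2 with hyd | hyd
  · exact ⟨d, hd7, hxd, hyd⟩
  · refine ⟨-d, fun h ↦ hd7 (by rwa [dvd_neg] at h), ?_, ?_⟩
    · rw [(X_Y_neg d).1]; exact hxd
    · rw [(X_Y_neg d).2]; exact hyd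

end DivisionPoints

/-! ## §4 The division values are algebraic over `ℚ` -/

section Integral

/-- **`X_c` and `Y_c` are integral over `ℚ`** (`49 X_c, 343 Y_c ∈ ℤ̄` by `torsion_coord_isIntegral`). [cite: SilvermanAEC2009, VII.3.4] -/
theorem isIntegral_X_Y {c : GaussianInt} (hc : ¬ (7 : GaussianInt) ∣ c) :
    IsIntegral ℚ (℘[ofUpperHalfPlane UpperHalfPlane.I] (((c : GaussianInt) : ℂ) / 7) / ((Real.Gamma (1 / 4) ^ 2 / (2 * Real.sqrt (2 * Real.pi)) : ℝ) : ℂ) ^ 2) ∧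
    IsIntegral ℚ (℘'[ofUpperHalfPlane UpperHalfPlane.I] (((c : GaussianInt) : ℂ) / 7) / (2 * ((Real.Gamma (1 / 4) ^ 2 / (2 * Real.sqrt (2 * Real.pi)) : ℝ) : ℂ) ^ 3)) := by
  obtain ⟨hX, hY⟩ := torsion_coord_isIntegral (n := 7) (div_seven_notMem hc) (by exact_mod_cast seven_mul_div_seven_mem c) (by norm_num)
  have hX' : IsIntegral ℚ ((7 : ℂ) ^ 2 * _) := hX.tower_top
  have hY' : IsIntegral ℚ ((7 : ℂ) ^ 3 * _) := hY.tower_top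
  constructor
  · have h := hX'.smul ((7 : ℚ) ^ 2)⁻¹
    rw [Rat.smul_def, Rat.cast_inv, Rat.cast_pow, Rat.cast_ofNat, ← mul_assoc,
      inv_mul_cancel₀ (by norm_num : (7 : ℂ) ^ 2 ≠ 0), one_mul] at h
    exact h
  · have h := hY'.smul ((7 : ℚ) ^ 3)⁻¹
    rw [Rat.smul_def, Rat.cast_inv, Rat.cast_pow, Rat.cast_ofNat, ← mul_assoc,
      inv_mul_cancel₀ (by norm_num : (7 : ℂ) ^ 3 ≠ 0), one_mul] at h
    exact h

end Integral

end Summit.BirchSwinnertonDyer.BirchSwinnertonDyer.Theorems.BiquadraticEisensteinDescentManinDatumSupercuspidalCMInertSevenDivisionField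

end
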